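import Summits.Parity.BatemanHorn.Theorems.AlmostPrimeZerosSystemZeroRepulsionApCharBoundNonprincipal
import Summits.Parity.BatemanHorn.Theorems.AlmostPrimeZerosSystemZeroRepulsionApLogL
import Summits.Parity.BatemanHorn.Theorems.AlmostPrimeZerosDiscMajorantLogGrowingDiscX
import HarnessLib

/-!
# Crux `DiscMajorantLog` (stmt-Parity-17114), line `Sketch`, stub `stub_apCharBoundSharpOfParts`

Support lemma for the crux `Summit.Parity.BatemanHorn.Theses.AlmostPrimeZeros.DiscMajorantLog`
(line `Sketch`): the per-character SHARP Selberg–Delange bound on the GROWING disc.  For the cell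
`f = aX + b` (`a ≥ 2`) one decomposes the progression `m ≡ b (mod a)` into Dirichlet characters;
this file bounds ONE character sum `Σ_{0<n≤y} χ(n) z^{s(n)}` (`s(n) = Σ_{p^v ∥ n} min(v,2)`) at the
crux's own constants — radius `‖z − 1‖ ≤ 3 log log y`, exponent `(log y)^{Re z − 1}`, Γ-budget
`e^{C‖z−1‖ log(‖z−1‖+2)}` — from two hypotheses taken BY NAME from the skeleton: (H3) the sharp
twisted Euler data `stub_apTwistedEulerDataSharp` and (H4) the thin-wide pole-free Riesz engine
`stub_apHolRieszBoundThinWide`.  Route = the landed `NearFar.stub_apCharBound{Principal,Nonprincipal}`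
at the constants of `stub_growingDiscXOfParts`: `R = 1 + ‖z−1‖ ≤ 4 log log y`, `h = y e^{−(log log y)³}`,
de-smoothing `NearFar.desmooth` + E3 `stub_shortIntervalWide` (+ `stub_rankinMajorant`); `χ₀` through
the sharp `ζ^z` engine E2b∘E2a (`stub_rieszDiffEngineWideOfNegligible stub_rieszDiffNegligibleWide`);
`χ ≠ χ₀` through H4 with `F = exp(z ℓ_χ) G` on `zfr (c₀/(R+1))`, `c₀ = min c_χ (log 4/4)` (`ℓ_χ` from
`stub_apLogL`); budget shift `GrowingDiscX.budget_shift`.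

References: H. L. Montgomery, R. C. Vaughan, *Multiplicative Number Theory I*, CUP 2007, §7.4
(Theorems 7.17–7.18), §11.1, §11.3; G. Tenenbaum, *Introduction to analytic and probabilistic
number theory*, II.5.
-/

noncomputable section

namespace Summit.Parity.BatemanHorn.Cruxes.DiscMajorantLog.Sketch

open scoped BigOperators
open Literature.NumberTheory.LFunctions
open Summit.Parity.BatemanHorn.Cruxes.SystemZeroRepulsion.NearFar
open Summit.Parity.BatemanHorn.Cruxes.LinearCappedRepulsion.JensenStieltjesMajorant

namespace ApCharBoundSharp

/-- Radius bookkeeping: `‖z‖ ≤ 1 + ‖z − 1‖` and `−‖z − 1‖ ≤ Re z − 1`. [folklore] -/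
theorem norm_le_and_re {z : ℂ} : ‖z‖ ≤ 1 + ‖z - 1‖ ∧ -‖z - 1‖ ≤ z.re - 1 := by
  constructor
  · have h := norm_add_le (z - 1) 1
    simp only [sub_add_cancel, norm_one] at h
    linarith
  · have h1 : |(z - 1).re| ≤ ‖z - 1‖ := Complex.abs_re_le_norm _
    have h2 : (z - 1).re = z.re - 1 := by simp
    rw [h2] at h1
    linarith [neg_abs_le (z.re - 1)]

/-- The coefficients `a(n) = χ(n) z^{s(n)}` satisfy `‖a(n)‖ ≤ R^{s(n)}` when `‖z‖ ≤ R`. [folklore] -/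
theorem norm_coeff_le {q : ℕ} (χ : DirichletCharacter ℂ q) {z : ℂ} {R : ℝ} (hzR : ‖z‖ ≤ R) (n : ℕ) :
    ‖χ (n : ZMod q) * z ^ (n.factorization.sum fun _ v => min v 2)‖ ≤
      R ^ (n.factorization.sum fun _ v => min v 2) := by
  rw [norm_mul, norm_pow]
  calc ‖χ (n : ZMod q)‖ * ‖z‖ ^ (n.factorization.sum fun _ v => min v 2)
      ≤ 1 * R ^ (n.factorization.sum fun _ v => min v 2) :=
        mul_le_mul (DirichletCharacter.norm_le_one _ _) (pow_le_pow_left₀ (norm_nonneg _) hzR _)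
          (by positivity) zero_le_one
    _ = _ := one_mul _

/-- The threshold `y ≥ ⌈exp(exp 1)⌉₊` gives `y > 0`, `log y ≥ 1`, `log log y ≥ 1`. [folklore] -/
theorem threshold {y : ℕ} (hy : ⌈Real.exp (Real.exp 1)⌉₊ ≤ y) :
    (0 : ℝ) < y ∧ 1 ≤ Real.log y ∧ 1 ≤ Real.log (Real.log y) := by
  have hyexp : Real.exp (Real.exp 1) ≤ (y : ℝ) := (Nat.le_ceil _).trans (by exact_mod_cast hy)
  have hypos : (0 : ℝ) < y := (Real.exp_pos _).trans_le hyexp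
  have hlog : Real.exp 1 ≤ Real.log y := (Real.le_log_iff_exp_le hypos).2 hyexp
  have hlogpos : 0 < Real.log y := (Real.exp_pos _).trans_le hlog
  refine ⟨hypos, ?_, (Real.le_log_iff_exp_le hlogpos).2 hlog⟩
  have : (1 : ℝ) ≤ Real.exp 1 := Real.one_le_exp (by norm_num)
  linarith

/-- The step `h = y e^{−(log log y)³}` satisfies `0 < h ≤ y` for `y > 0`, `log log y ≥ 1`. [folklore] -/
theorem step_pos_le {y : ℝ} (hy : 0 < y) (hL : 1 ≤ Real.log (Real.log y)) :
    0 < y * Real.exp (-(Real.log (Real.log y) ^ 3)) ∧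
      y * Real.exp (-(Real.log (Real.log y) ^ 3)) ≤ y := by
  refine ⟨mul_pos hy (Real.exp_pos _), ?_⟩
  have hL0 : 0 ≤ Real.log (Real.log y) := by linarith
  have : Real.exp (-(Real.log (Real.log y) ^ 3)) ≤ 1 := by
    rw [Real.exp_le_one_iff, neg_nonpos]; positivity
  calc y * Real.exp (-(Real.log (Real.log y) ^ 3)) ≤ y * 1 := by gcongr
    _ = y := mul_one _

/-- Points of `zfr (c₀/(R+1))` with `0 ≤ c₀ ≤ min c (log 4/4)`, `R ≥ 0` lie in `zfr c` and have
`Re s > 1 − 1/(4(R+1))` (as `log(|t|+4) ≥ log 4 ≥ 4c₀`). [folklore] -/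
theorem mem_zfr_div {c₀ c R : ℝ} (hc₀ : 0 ≤ c₀) (hc₀c : c₀ ≤ c) (hc₀4 : c₀ ≤ Real.log 4 / 4)
    (hR : 0 ≤ R) {s : ℂ} (hs : s ∈ ClassicalPsiData.zfr (c₀ / (R + 1))) :
    s ∈ ClassicalPsiData.zfr c ∧ 1 - 1 / (4 * (R + 1)) < s.re := by
  refine ⟨ClassicalPsiData.zfr_mono ((div_le_self hc₀ (by linarith)).trans hc₀c) hs, ?_⟩
  rw [ClassicalPsiData.mem_zfr] at hs
  have h4 : 0 < Real.log 4 := Real.log_pos (by norm_num)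
  have hℓ : Real.log 4 ≤ Real.log (|s.im| + 4) :=
    Real.log_le_log (by norm_num) (by linarith [abs_nonneg s.im])
  have hℓ0 : 0 < Real.log (|s.im| + 4) := h4.trans_le hℓ
  have h1 : c₀ / (R + 1) / Real.log (|s.im| + 4) ≤ 1 / (4 * (R + 1)) := by
    rw [div_div, div_le_div_iff₀ (by positivity) (by positivity)]
    nlinarith
  linarith

/-- **The common tail** (de-smoothing + `(log y)^{−R−1} ≤ (log y)^{Re z − 1}`): if `‖a(n)‖ ≤ R^{s(n)}`,
`‖A₁(y+h) − A₁(y)‖ ≤ h·y·(log y)^{Re z−1}·M` and `Σ_{y<n≤y+h} R^{s(n)} ≤ y (log y)^{−R−1}` with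
`log y ≥ 1`, `−R − 1 ≤ Re z − 1`, then `‖Σ_{0<n≤y} a(n)‖ ≤ y (log y)^{Re z−1} (M + 1)`. [folklore] -/
theorem desmooth_tail {a : ℕ → ℂ} {R : ℝ} (ha : ∀ n, ‖a n‖ ≤ R ^ (n.factorization.sum fun _ v => min v 2))
    {y : ℕ} {h M : ℝ} {z : ℂ} (hh : 0 < h) (h𝓛 : 1 ≤ Real.log y) (hRz : -R - 1 ≤ z.re - 1)
    (hD : ‖(∑ n ∈ Finset.Ioc 0 ⌊(y : ℝ) + h⌋₊, a n * ((((y : ℝ) + h : ℝ) : ℂ) - n)) -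
        ∑ n ∈ Finset.Ioc 0 ⌊(y : ℝ)⌋₊, a n * (((y : ℝ) : ℂ) - n)‖ ≤
        h * y * Real.log y ^ (z.re - 1) * M)
    (hS : ∑ n ∈ Finset.Ioc y ⌊(y : ℝ) + y * Real.exp (-(Real.log (Real.log y) ^ 3))⌋₊,
        R ^ (n.factorization.sum fun _ v => min v 2) ≤ (y : ℝ) * Real.log y ^ (-R - 1))
    (hhy : h = y * Real.exp (-(Real.log (Real.log y) ^ 3))) :
    ‖∑ n ∈ Finset.Ioc 0 y, a n‖ ≤ (y : ℝ) * Real.log y ^ (z.re - 1) * (M + 1) := by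
  rw [← hhy] at hS
  have hdes := desmooth ha hh hD hS
  have hmono : Real.log y ^ (-R - 1) ≤ Real.log y ^ (z.re - 1) :=
    Real.rpow_le_rpow_of_exponent_le h𝓛 hRz
  have h3 : h * ‖∑ n ∈ Finset.Ioc 0 y, a n‖ ≤
      h * ((y : ℝ) * Real.log y ^ (z.re - 1) * (M + 1)) := by
    calc h * ‖∑ n ∈ Finset.Ioc 0 y, a n‖
        ≤ h * y * Real.log y ^ (z.re - 1) * M + h * ((y : ℝ) * Real.log y ^ (-R - 1)) := hdes
      _ ≤ h * y * Real.log y ^ (z.re - 1) * M + h * ((y : ℝ) * Real.log y ^ (z.re - 1)) := by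
          gcongr
      _ = h * ((y : ℝ) * Real.log y ^ (z.re - 1) * (M + 1)) := by ring
  exact le_of_mul_le_mul_left h3 hh

/-- **The final assembly with the budget shift**: from `S ≤ y·P·(M + 1)`, `y·P ≥ 0`,
`M ≤ N e^{b(1+R)log(R+2)}` (`b, N ≥ 0`, `R = 1 + r`, `r ≥ 0`) conclude
`S ≤ (N+1) e^{3b} · y · P · e^{3b·r·log(r+2)}` (by `(2+r)log(r+3) ≤ 3 r log(r+2) + 3`). [folklore] -/
theorem budget_finish {S y P M N b r R : ℝ} (hS : S ≤ y * P * (M + 1)) (hyP : 0 ≤ y * P)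
    (hM : M ≤ N * Real.exp (b * (1 + R) * Real.log (R + 2))) (hb : 0 ≤ b) (hr : 0 ≤ r)
    (hR : R = 1 + r) (hN : 0 ≤ N) :
    S ≤ (N + 1) * Real.exp (3 * b) * y * P * Real.exp (3 * b * r * Real.log (r + 2)) := by
  have hshift := GrowingDiscX.budget_shift hr
  have e1 : 1 + R = 2 + r := by rw [hR]; ring
  have e2 : R + 2 = r + 3 := by rw [hR]; ring
  rw [e1, e2] at hM
  have h1 : b * (2 + r) * Real.log (r + 3) ≤ 3 * b + 3 * b * r * Real.log (r + 2) := by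
    have := mul_le_mul_of_nonneg_left hshift hb
    nlinarith
  have h2 : Real.exp (b * (2 + r) * Real.log (r + 3)) ≤
      Real.exp (3 * b) * Real.exp (3 * b * r * Real.log (r + 2)) := by
    rw [← Real.exp_add]; exact Real.exp_le_exp.2 h1
  have h3 : 1 ≤ Real.exp (3 * b) * Real.exp (3 * b * r * Real.log (r + 2)) := by
    rw [← Real.exp_add]
    refine Real.one_le_exp ?_
    have : 0 ≤ Real.log (r + 2) := Real.log_nonneg (by linarith)
    positivity
  have h4 : M + 1 ≤ (N + 1) * Real.exp (3 * b) * Real.exp (3 * b * r * Real.log (r + 2)) := by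
    nlinarith [mul_le_mul_of_nonneg_left h2 hN]
  calc S ≤ y * P * (M + 1) := hS
    _ ≤ y * P * ((N + 1) * Real.exp (3 * b) * Real.exp (3 * b * r * Real.log (r + 2))) :=
        mul_le_mul_of_nonneg_left h4 hyP
    _ = _ := by ring

end ApCharBoundSharp

open ApCharBoundSharp

/-- **The principal character at the sharp constants.**  Given the sharp twisted Euler data (H3, the
statement of `stub_apTwistedEulerDataSharp`), for every `q ≥ 1` there are `A, C, y₀` with
`‖Σ_{0<n≤y} χ₀(n) z^{s(n)}‖ ≤ A·y·(log y)^{Re z − 1}·exp(C‖z−1‖ log(‖z−1‖+2))` for `y ≥ y₀`,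
`‖z − 1‖ ≤ 3 log log y`: the last clause of H3 is `RieszData R (1 − 1/(4(R+1))) B z a G₁`, fed to the
landed sharp `ζ^z` engine `stub_rieszDiffEngineWideOfNegligible stub_rieszDiffNegligibleWide`
(`R = 1 + ‖z−1‖ ≤ 4 log log y`, `h = y e^{−(log log y)³}`), then `desmooth_tail` and `budget_finish`.
Constants `A = 2e^{3(b+c)}`, `C = 3(b+c)`. [cite: MontgomeryVaughan2007, §7.4 Theorems 7.17–7.18] -/
theorem apCharBoundSharp_principal
    (hH3 : ∀ (q : ℕ) [NeZero q] (χ : DirichletCharacter ℂ q), ∃ b : ℝ, 0 ≤ b ∧ ∀ R : ℝ, 0 ≤ R →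
      ∀ z : ℂ, ‖z‖ ≤ R → ∃ G : ℂ → ℂ, DifferentiableOn ℂ G {s : ℂ | 1 / 2 < s.re} ∧
        (∀ s : ℂ, 1 - 1 / (4 * (R + 1)) < s.re → ‖G s‖ ≤ Real.exp (b * (1 + R) * Real.log (R + 2))) ∧
        (∀ σ : ℝ, 1 < σ →
          LSeriesSummable (fun n : ℕ => χ (n : ZMod q) * z ^ (n.factorization.sum fun _ v => min v 2)) σ) ∧
        (∀ s : ℂ, 1 < s.re →
          LSeries (fun n : ℕ => χ (n : ZMod q) * z ^ (n.factorization.sum fun _ v => min v 2)) s =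
            Complex.exp (z * ∑' p : Nat.Primes,
              -Complex.log (1 - χ ((p : ℕ) : ZMod q) * ((p : ℕ) : ℂ) ^ (-s))) * G s) ∧
        (∀ σ : ℝ, 1 < σ → σ ≤ 2 →
          ∑' n : ℕ, ‖LSeries.term (fun n : ℕ => χ (n : ZMod q) *
            z ^ (n.factorization.sum fun _ v => min v 2)) σ n‖ ≤
            Real.exp (b * (1 + R) * Real.log (R + 2)) / (σ - 1) ^ R) ∧
        (χ = 1 → Literature.NumberTheory.LFunctions.SelbergDelange.RieszData R (1 - 1 / (4 * (R + 1)))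
          (Real.exp (b * (1 + R) * Real.log (R + 2))) z
          (fun n : ℕ => χ (n : ZMod q) * z ^ (n.factorization.sum fun _ v => min v 2))
          (fun s : ℂ => G s * Complex.exp (z * ∑ p ∈ q.primeFactors,
            Complex.log (1 - ((p : ℕ) : ℂ) ^ (-s))))))
    (q : ℕ) [NeZero q] :
    ∃ A C : ℝ, ∃ y₀ : ℕ, ∀ y : ℕ, y₀ ≤ y → ∀ z : ℂ, ‖z - 1‖ ≤ 3 * Real.log (Real.log (y : ℝ)) →
      ‖∑ n ∈ Finset.Ioc 0 y, (1 : DirichletCharacter ℂ q) (n : ZMod q) *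
          z ^ (n.factorization.sum fun _ v => min v 2)‖ ≤
        A * (y : ℝ) * Real.log (y : ℝ) ^ (z.re - 1) *
          Real.exp (C * ‖z - 1‖ * Real.log (‖z - 1‖ + 2)) := by
  obtain ⟨b, hb0, hEul⟩ := hH3 q (1 : DirichletCharacter ℂ q)
  obtain ⟨X₀, c, hc0, hEng⟩ := stub_rieszDiffEngineWideOfNegligible stub_rieszDiffNegligibleWide
  obtain ⟨Br, hBr0, hrank⟩ := stub_rankinMajorant
  obtain ⟨x₁, hshort⟩ := stub_shortIntervalWide Br hBr0 hrank
  refine ⟨(1 + 1) * Real.exp (3 * (b + c)), 3 * (b + c), max (max x₁ ⌈X₀⌉₊) ⌈Real.exp (Real.exp 1)⌉₊,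
    fun y hy z hz => ?_⟩
  -- the threshold
  have hx₁ : x₁ ≤ y := le_trans ((le_max_left _ _).trans (le_max_left _ _)) hy
  have hX₀ : X₀ ≤ (y : ℝ) :=
    (Nat.le_ceil X₀).trans (by exact_mod_cast ((le_max_right _ _).trans (le_max_left _ _)).trans hy)
  obtain ⟨hypos, h𝓛1, hL1⟩ := threshold ((le_max_right _ _).trans hy)
  -- the radius
  set r : ℝ := ‖z - 1‖ with hrdef
  have hr0 : 0 ≤ r := norm_nonneg _
  set R : ℝ := 1 + r with hRdef
  have hR1 : 1 ≤ R := by rw [hRdef]; linarith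
  obtain ⟨hzR', hrez'⟩ := norm_le_and_re (z := z)
  have hzR : ‖z‖ ≤ R := hzR'
  have hR4 : R ≤ 4 * Real.log (Real.log (y : ℝ)) := by rw [hRdef]; linarith
  have hrez : -R - 1 ≤ z.re - 1 := by rw [hRdef]; linarith
  -- the data and the engine
  obtain ⟨G, -, -, -, -, -, hRD⟩ := hEul R (by linarith) z hzR
  obtain ⟨hhpos, hhx⟩ := step_pos_le hypos hL1
  have hEngx := hEng R _ z _ _ hR1 (hRD rfl) y _ hX₀ hR4 le_rfl hhx
  have hT := desmooth_tail (norm_coeff_le (1 : DirichletCharacter ℂ q) hzR) hhpos h𝓛1 hrez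
    (M := Real.exp (b * (1 + R) * Real.log (R + 2)) * Real.exp (c * (1 + R) * Real.log (R + 2)))
    (hEngx.trans_eq (mul_assoc _ _ _)) (hshort y hx₁ R hR1 hR4) rfl
  refine budget_finish hT (by positivity) (le_of_eq ?_) (by positivity : (0 : ℝ) ≤ b + c) hr0 hRdef
    zero_le_one
  rw [one_mul, ← Real.exp_add]; ring_nf

/-- **The non-principal characters at the sharp constants.**  Given H3 and the thin-wide pole-free
Riesz engine (H4, the statement of `stub_apHolRieszBoundThinWide`), for every `χ ≠ χ₀ mod q` there are
`A, C, y₀` with `‖Σ_{0<n≤y} χ(n) z^{s(n)}‖ ≤ A·y·(log y)^{Re z − 1}·exp(C‖z−1‖ log(‖z−1‖+2))` for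
`y ≥ y₀`, `‖z − 1‖ ≤ 3 log log y`: `F = exp(z ℓ_χ) G` (`ℓ_χ` from `stub_apLogL`) is holomorphic on
`zfr (c₀/(R+1))`, `c₀ = min c_χ (log 4/4)`, with `‖F‖ ≤ B (e^{C_χ} log(|t|+4))^R`; H4 at `x = y` and
`x = y + h` makes both Riesz means `≤ 4 y h (log y)^{−R} B`, then `desmooth_tail` and `budget_finish`.
Constants `A = 6e^{3b}`, `C = 3b`. [cite: MontgomeryVaughan2007, §11.3 and §7.4] -/
theorem apCharBoundSharp_nonprincipal
    (hH3 : ∀ (q : ℕ) [NeZero q] (χ : DirichletCharacter ℂ q), ∃ b : ℝ, 0 ≤ b ∧ ∀ R : ℝ, 0 ≤ R →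
      ∀ z : ℂ, ‖z‖ ≤ R → ∃ G : ℂ → ℂ, DifferentiableOn ℂ G {s : ℂ | 1 / 2 < s.re} ∧
        (∀ s : ℂ, 1 - 1 / (4 * (R + 1)) < s.re → ‖G s‖ ≤ Real.exp (b * (1 + R) * Real.log (R + 2))) ∧
        (∀ σ : ℝ, 1 < σ →
          LSeriesSummable (fun n : ℕ => χ (n : ZMod q) * z ^ (n.factorization.sum fun _ v => min v 2)) σ) ∧
        (∀ s : ℂ, 1 < s.re →
          LSeries (fun n : ℕ => χ (n : ZMod q) * z ^ (n.factorization.sum fun _ v => min v 2)) s =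
            Complex.exp (z * ∑' p : Nat.Primes,
              -Complex.log (1 - χ ((p : ℕ) : ZMod q) * ((p : ℕ) : ℂ) ^ (-s))) * G s) ∧
        (∀ σ : ℝ, 1 < σ → σ ≤ 2 →
          ∑' n : ℕ, ‖LSeries.term (fun n : ℕ => χ (n : ZMod q) *
            z ^ (n.factorization.sum fun _ v => min v 2)) σ n‖ ≤
            Real.exp (b * (1 + R) * Real.log (R + 2)) / (σ - 1) ^ R) ∧
        (χ = 1 → Literature.NumberTheory.LFunctions.SelbergDelange.RieszData R (1 - 1 / (4 * (R + 1)))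
          (Real.exp (b * (1 + R) * Real.log (R + 2))) z
          (fun n : ℕ => χ (n : ZMod q) * z ^ (n.factorization.sum fun _ v => min v 2))
          (fun s : ℂ => G s * Complex.exp (z * ∑ p ∈ q.primeFactors,
            Complex.log (1 - ((p : ℕ) : ℂ) ^ (-s))))))
    (hH4 : ∀ (c K : ℝ), 0 < c → 1 ≤ K → ∃ X₀ : ℝ, ∀ (R B : ℝ) (a : ℕ → ℂ) (F : ℂ → ℂ), 1 ≤ R → 0 ≤ B →
      DifferentiableOn ℂ F (Literature.NumberTheory.LFunctions.ClassicalPsiData.zfr (c / (R + 1))) →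
      (∀ s ∈ Literature.NumberTheory.LFunctions.ClassicalPsiData.zfr (c / (R + 1)),
        ‖F s‖ ≤ B * (K * Real.log (|s.im| + 4)) ^ R) →
      (∀ σ : ℝ, 1 < σ → LSeriesSummable a σ) →
      (∀ s : ℂ, 1 < s.re → LSeries a s = F s) →
      (∀ σ : ℝ, 1 < σ → σ ≤ 2 → ∑' n : ℕ, ‖LSeries.term a σ n‖ ≤ B / (σ - 1) ^ R) →
      ∀ x : ℝ, X₀ ≤ x → R ≤ 4 * Real.log (Real.log x) + 4 →
        ‖∑ n ∈ Finset.Ioc 0 ⌊x⌋₊, a n * ((x : ℂ) - n)‖ ≤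
          x ^ 2 * Real.log x ^ (-R) * Real.exp (-(Real.log (Real.log x)) ^ 3) * B)
    (q : ℕ) [NeZero q] (χ : DirichletCharacter ℂ q) (hχ : χ ≠ 1) :
    ∃ A C : ℝ, ∃ y₀ : ℕ, ∀ y : ℕ, y₀ ≤ y → ∀ z : ℂ, ‖z - 1‖ ≤ 3 * Real.log (Real.log (y : ℝ)) →
      ‖∑ n ∈ Finset.Ioc 0 y, χ (n : ZMod q) * z ^ (n.factorization.sum fun _ v => min v 2)‖ ≤
        A * (y : ℝ) * Real.log (y : ℝ) ^ (z.re - 1) *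
          Real.exp (C * ‖z - 1‖ * Real.log (‖z - 1‖ + 2)) := by
  obtain ⟨b, hb0, hEul⟩ := hH3 q χ
  obtain ⟨cχ, hcχ, Cχ, hCχ0, ℓ, hℓdiff, hℓbd, hℓeq⟩ := stub_apLogL q χ hχ
  -- the region constant and the engine threshold
  set c₀ : ℝ := min cχ (Real.log 4 / 4) with hc₀def
  have h4 : 0 < Real.log 4 := Real.log_pos (by norm_num)
  have hc₀ : 0 < c₀ := lt_min hcχ (by positivity)
  have hc₀χ : c₀ ≤ cχ := min_le_left _ _
  have hc₀4 : c₀ ≤ Real.log 4 / 4 := min_le_right _ _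
  set K : ℝ := Real.exp Cχ with hKdef
  obtain ⟨X₀, hHol⟩ := hH4 c₀ K hc₀ (Real.one_le_exp hCχ0)
  obtain ⟨Br, hBr0, hrank⟩ := stub_rankinMajorant
  obtain ⟨x₁, hshort⟩ := stub_shortIntervalWide Br hBr0 hrank
  refine ⟨(5 + 1) * Real.exp (3 * b), 3 * b, max (max x₁ ⌈X₀⌉₊) ⌈Real.exp (Real.exp 1)⌉₊,
    fun y hy z hz => ?_⟩
  -- the threshold
  have hx₁ : x₁ ≤ y := le_trans ((le_max_left _ _).trans (le_max_left _ _)) hy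
  have hX₀ : X₀ ≤ (y : ℝ) :=
    (Nat.le_ceil X₀).trans (by exact_mod_cast ((le_max_right _ _).trans (le_max_left _ _)).trans hy)
  obtain ⟨hypos, h𝓛1, hL1⟩ := threshold ((le_max_right _ _).trans hy)
  set 𝓛 : ℝ := Real.log y with h𝓛def
  set L : ℝ := Real.log 𝓛 with hLdef
  have h𝓛pos : 0 < 𝓛 := by linarith
  -- the radius
  set r : ℝ := ‖z - 1‖ with hrdef
  have hr0 : 0 ≤ r := norm_nonneg _
  set R : ℝ := 1 + r with hRdef
  have hR1 : 1 ≤ R := by rw [hRdef]; linarith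
  have hR0 : 0 ≤ R := by linarith
  obtain ⟨hzR', hrez'⟩ := norm_le_and_re (z := z)
  have hzR : ‖z‖ ≤ R := hzR'
  have hR4 : R ≤ 4 * L := by rw [hRdef]; linarith
  have hrez : -R - 1 ≤ z.re - 1 := by rw [hRdef]; linarith
  -- the data: `F = e^{zℓ} G`
  obtain ⟨G, hGdiff, hGbd, hsum, hLser, hmaj, -⟩ := hEul R hR0 z hzR
  set B : ℝ := Real.exp (b * (1 + R) * Real.log (R + 2)) with hBdef
  have hB0 : 0 ≤ B := (Real.exp_pos _).le
  set sfun : ℕ → ℕ := fun n => n.factorization.sum fun _ v => min v 2 with hsfun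
  set a : ℕ → ℂ := fun n => χ (n : ZMod q) * z ^ sfun n with hadef
  set F : ℂ → ℂ := fun s => Complex.exp (z * ℓ s) * G s with hFdef
  have hzfr : ∀ s ∈ ClassicalPsiData.zfr (c₀ / (R + 1)),
      s ∈ ClassicalPsiData.zfr cχ ∧ 1 - 1 / (4 * (R + 1)) < s.re :=
    fun s hs => mem_zfr_div hc₀.le hc₀χ hc₀4 hR0 hs
  have hFdiff : DifferentiableOn ℂ F (ClassicalPsiData.zfr (c₀ / (R + 1))) := by
    intro s hs
    obtain ⟨hs1, hre⟩ := hzfr s hs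
    have h1 : DifferentiableAt ℂ ℓ s :=
      hℓdiff.differentiableAt ((ClassicalPsiData.isOpen_zfr cχ).mem_nhds hs1)
    have hre2 : 1 / 2 < s.re := by
      have : 1 / (4 * (R + 1)) ≤ 1 / 4 := by
        rw [div_le_div_iff₀ (by positivity) (by norm_num)]; linarith
      linarith
    have h2 : DifferentiableAt ℂ G s :=
      hGdiff.differentiableAt ((isOpen_lt continuous_const Complex.continuous_re).mem_nhds hre2)
    exact (((differentiableAt_const z).mul h1).cexp.mul h2).differentiableWithinAt
  have hFbd : ∀ s ∈ ClassicalPsiData.zfr (c₀ / (R + 1)), ‖F s‖ ≤ B * (K * Real.log (|s.im| + 4)) ^ R := by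
    intro s hs
    obtain ⟨hs1, hre⟩ := hzfr s hs
    have hℒ : 0 < Real.log (|s.im| + 4) :=
      h4.trans_le (Real.log_le_log (by norm_num) (by linarith [abs_nonneg s.im]))
    have h1 := norm_exp_mul_le_rpow hzR hℒ (hℓbd s hs1)
    have h2 := hGbd s hre
    rw [hFdef]
    simp only [norm_mul]
    calc ‖Complex.exp (z * ℓ s)‖ * ‖G s‖ ≤ (Real.exp Cχ * Real.log (|s.im| + 4)) ^ R * B :=
          mul_le_mul h1 h2 (norm_nonneg _) (by positivity)
      _ = B * (K * Real.log (|s.im| + 4)) ^ R := by rw [hKdef, mul_comm]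
  have hLeq : ∀ s : ℂ, 1 < s.re → LSeries a s = F s := by
    intro s hs
    rw [hadef, hFdef]
    simp only
    rw [hLser s hs, ← hℓeq s hs]
  have hHolx := hHol R B a F hR1 hB0 hFdiff hFbd (by simpa [hadef, hsfun] using hsum) hLeq
    (by simpa [hadef, hsfun] using hmaj)
  -- the two Riesz means are negligible
  obtain ⟨hhpos, hhx⟩ := step_pos_le hypos hL1
  set h : ℝ := (y : ℝ) * Real.exp (-(Real.log (Real.log y) ^ 3)) with hhdef
  have hyh : (y : ℝ) ≤ y + h := by linarith
  have hlogyh : 𝓛 ≤ Real.log ((y : ℝ) + h) := Real.log_le_log hypos hyh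
  have hLyh : L ≤ Real.log (Real.log ((y : ℝ) + h)) := Real.log_le_log h𝓛pos hlogyh
  have hA1 := hHolx ((y : ℝ) + h) (hX₀.trans hyh) (by linarith)
  have hA0' := hHolx (y : ℝ) hX₀ (by linarith)
  -- their bounds: `≤ 4 y h 𝓛^{−R} B` and `≤ y h 𝓛^{−R} B`
  have hL0 : 0 < L := by linarith
  have hbd1 : ((y : ℝ) + h) ^ 2 * Real.log ((y : ℝ) + h) ^ (-R) *
      Real.exp (-(Real.log (Real.log ((y : ℝ) + h))) ^ 3) * B ≤ 4 * (y * h * 𝓛 ^ (-R) * B) := by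
    have e1 : ((y : ℝ) + h) ^ 2 ≤ 4 * (y : ℝ) ^ 2 := by nlinarith
    have e2 : Real.log ((y : ℝ) + h) ^ (-R) ≤ 𝓛 ^ (-R) :=
      Real.rpow_le_rpow_of_nonpos h𝓛pos hlogyh (by linarith)
    have e3 : Real.exp (-(Real.log (Real.log ((y : ℝ) + h))) ^ 3) ≤ Real.exp (-L ^ 3) := by
      rw [Real.exp_le_exp, neg_le_neg_iff]
      exact pow_le_pow_left₀ hL0.le hLyh 3
    have e4 : (y : ℝ) ^ 2 * Real.exp (-L ^ 3) = y * h := by rw [hhdef, hLdef, h𝓛def]; ring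
    have e5 : 0 ≤ Real.log ((y : ℝ) + h) ^ (-R) := Real.rpow_nonneg (by linarith) _
    calc ((y : ℝ) + h) ^ 2 * Real.log ((y : ℝ) + h) ^ (-R) *
          Real.exp (-(Real.log (Real.log ((y : ℝ) + h))) ^ 3) * B
        ≤ (4 * (y : ℝ) ^ 2) * 𝓛 ^ (-R) * Real.exp (-L ^ 3) * B := by gcongr
      _ = 4 * (y * h * 𝓛 ^ (-R) * B) := by rw [← e4]; ring
  have hbd0 : (y : ℝ) ^ 2 * Real.log (y : ℝ) ^ (-R) *
      Real.exp (-(Real.log (Real.log (y : ℝ))) ^ 3) * B = y * h * 𝓛 ^ (-R) * B := by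
    rw [hhdef]; ring
  have h𝓛mono' : 𝓛 ^ (-R) ≤ 𝓛 ^ (z.re - 1) :=
    Real.rpow_le_rpow_of_exponent_le h𝓛1 (by linarith)
  have hdiff : ‖(∑ n ∈ Finset.Ioc 0 ⌊(y : ℝ) + h⌋₊, a n * ((((y : ℝ) + h : ℝ) : ℂ) - n)) -
      ∑ n ∈ Finset.Ioc 0 ⌊(y : ℝ)⌋₊, a n * (((y : ℝ) : ℂ) - n)‖ ≤
      h * y * 𝓛 ^ (z.re - 1) * (5 * B) := by
    refine (norm_sub_le _ _).trans ?_
    have h5 := add_le_add (hA1.trans hbd1) (le_of_eq hbd0 |>.trans' hA0')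
    have h6 : y * h * 𝓛 ^ (-R) * B ≤ y * h * 𝓛 ^ (z.re - 1) * B := by
      have : 0 ≤ (y : ℝ) * h := by positivity
      gcongr
    linarith
  have hT := desmooth_tail (fun n => norm_coeff_le χ hzR n) hhpos h𝓛1 hrez hdiff (hshort y hx₁ R hR1 hR4) rfl
  exact budget_finish hT (by positivity) (le_refl (5 * B)) hb0 hr0 hRdef (by norm_num)

/-- **Stub `stub_apCharBoundSharpOfParts` (registered, line `Sketch`): the per-character sharp
Selberg–Delange bound on the growing disc.**  From the sharp twisted Euler data (H3) and the thin-wide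
pole-free Riesz engine (H4): for every character `χ mod q` there are `A, C, y₀` with
`‖Σ_{0<n≤y} χ(n) z^{s(n)}‖ ≤ A·y·(log y)^{Re z − 1}·exp(C‖z−1‖ log(‖z−1‖+2))` for all `y ≥ y₀` and
all `‖z − 1‖ ≤ 3 log log y`.  Case split `χ = χ₀` (`apCharBoundSharp_principal`) / `χ ≠ χ₀`
(`apCharBoundSharp_nonprincipal`). [cite: MontgomeryVaughan2007, §7.4 Theorems 7.17–7.18 and §11.3] -/
theorem stub_apCharBoundSharpOfParts : (∀ (q : ℕ) [NeZero q] (χ : DirichletCharacter ℂ q), ∃ b : ℝ, 0 ≤ b ∧ ∀ R : ℝ, 0 ≤ R → ∀ z : ℂ, ‖z‖ ≤ R → ∃ G : ℂ → ℂ, DifferentiableOn ℂ G {s : ℂ | 1 / 2 < s.re} ∧ (∀ s : ℂ, 1 - 1 / (4 * (R + 1)) < s.re → ‖G s‖ ≤ Real.exp (b * (1 + R) * Real.log (R + 2))) ∧ (∀ σ : ℝ, 1 < σ → LSeriesSummable (fun n : ℕ => χ (n : ZMod q) * z ^ (n.factorization.sum fun _ v => min v 2)) σ) ∧ (∀ s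 : ℂ, 1 < s.re → LSeries (fun n : ℕ => χ (n : ZMod q) * z ^ (n.factorization.sum fun _ v => min v 2)) s = Complex.exp (z * ∑' p : Nat.Primes, -Complex.log (1 - χ ((p : ℕ) : ZMod q) * ((p : ℕ) : ℂ) ^ (-s))) * G s) ∧ (∀ σ : ℝ, 1 < σ → σ ≤ 2 → ∑' n : ℕ, ‖LSeries.term (fun n : ℕ => χ (n : ZMod q) * z ^ (n.factorization.sum fun _ v => min v 2)) σ n‖ ≤ Real.exp (b * (1 + R) * Real.log (R + 2)) / (σ - 1) ^ R) ∧ (χ = 1 → Literature.NumberTheory.LFunctions.SelbergDelange.RieszData R (1 - 1 / (4 * (R + 1))) (Real.exp (b * (1 + R) * Real.log (R + 2))) z (fun n : ℕ => χ (n : ZMod q) * z ^ (n.factorization.sum fun _ v => min v 2)) (fun s : ℂ => G s * Complex.exp (z * ∑ p ∈ q.primeFactors, Complex.log (1 - ((p : ℕ) : ℂ) ^ (-s)))))) → (∀ (c K : ℝ), 0 < c → 1 ≤ K → ∃ X₀ : ℝ, ∀ (R B : ℝ) (a : ℕ → ℂ) (F : ℂ → ℂ), 1 ≤ R → 0 ≤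 B → DifferentiableOn ℂ F (Literature.NumberTheory.LFunctions.ClassicalPsiData.zfr (c / (R + 1))) → (∀ s ∈ Literature.NumberTheory.LFunctions.ClassicalPsiData.zfr (c / (R + 1)), ‖F s‖ ≤ B * (K * Real.log (|s.im| + 4)) ^ R) → (∀ σ : ℝ, 1 < σ → LSeriesSummable a σ) → (∀ s : ℂ, 1 < s.re → LSeries a s = F s) → (∀ σ : ℝ, 1 < σ → σ ≤ 2 → ∑' n : ℕ, ‖LSeries.term a σ n‖ ≤ B / (σ - 1) ^ R) → ∀ x : ℝ, X₀ ≤ x → R ≤ 4 * Real.log (Real.log x) + 4 → ‖∑ n ∈ Finset.Ioc 0 ⌊x⌋₊, a n * ((x : ℂ) - n)‖ ≤ x ^ 2 * Real.log x ^ (-R) * Real.exp (-(Real.log (Real.log x)) ^ 3) * B) → ∀ (q : ℕ) [NeZero q] (χ : DirichletCharacter ℂ q), ∃ A C : ℝ, ∃ y₀ : ℕ, ∀ y : ℕ, y₀ ≤ y → ∀ z : ℂ, ‖z - 1‖ ≤ 3 * Real.log (Real.log (y : ℝ)) → ‖∑ n ∈ Finset.Ioc 0 y, χ (n : ZMod q)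 * z ^ (n.factorization.sum fun _ v => min v 2)‖ ≤ A * (y : ℝ) * Real.log (y : ℝ) ^ (z.re - 1) * Real.exp (C * ‖z - 1‖ * Real.log (‖z - 1‖ + 2)) := by
  intro hH3 hH4 q _ χ
  by_cases hχ : χ = 1
  · subst hχ
    exact apCharBoundSharp_principal hH3 q
  · exact apCharBoundSharp_nonprincipal hH3 hH4 q χ hχ

end Summit.Parity.BatemanHorn.Cruxes.DiscMajorantLog.Sketch

end
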